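import Literature.Probability.LatticeModels.LeftmostInterfaceTightness
import Literature.Probability.LatticeModels.RightmostInterface
import Literature.Probability.LatticeModels.IsingGibbsFlip
import Literature.Probability.RandomPlanarGeometry.ArcHullDomains
import HarnessLib

/-!
# Sub-Gaussian traversal bound and tightness for the rightmost critical Ising interface

Topic `Literature/Probability/LatticeModels` (family `crit-ising`). Companion of
`LeftmostInterfaceTightness.lean`, which proves the Aizenman–Burchard traversal bound (H1) and
the tightness of the laws of the **leftmost** critical Ising Dobrushin interface modulo the
FK-Ising RSW fact `fkIsing_rsw`. Chelkak–Duminil-Copin–Hongler–Kemppainen–Smirnov (C. R. Math.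
352 (2014), §1) state their Theorem 1 for "the rightmost (or the leftmost) interface"; this file
supplies the **rightmost** case (`RightmostInterface.rightmostInterface`) by the exact symmetry
of the model — the global spin flip `σ ↦ -σ` together with the exchange of the two boundary arcs
maps the `±` Dobrushin Ising measure of `(Ω_δ; A, B)` to that of `(Ω_δ; B, A)`
(`isingZdDobrushinMeasure_preimage_neg`, from `isingMeasure_fixed_map_neg` and the locality of
the finite-volume measure in the boundary condition) and the rightmost interface of `σ` to the
reversal of the leftmost interface of `-σ` (by definition) — so that no part of the sector /
successive-conditioning argument has to be repeated:

* `dobrushinDomainSwap D` — the Dobrushin domain `(D; b, a)` (same Jordan domain, boundary loop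
  re-based at `b`), whose arcs are those of `(D; a, b)` exchanged (`arc_dobrushinDomainSwap_zero`,
  `arc_dobrushinDomainSwap_one`); `IsDiscretisation.swap`: exchanging the arcs of a discretisation
  of `(D; a, b)` gives a discretisation of `(D; b, a)`;
* `hasTraversals_of_reparamDist_eq_zero` — separate traversals of a shell pass to any curve at
  reparametrisation distance `0`, up to an arbitrarily small shrinking of the shell (the list
  reversal of a polygon is its time reversal only modulo reparametrisation,
  `reparamDist_polyline_reverse`); `hasTraversals_spinPolygon_of_reverse`;
* `rightmostInterface_traversalBound_of_fkIsing_rsw` — **(H1) for the rightmost interface**: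
  `k`, `K ≥ 0`, `λ > 2`, `δ₀ > 0` with `μ(k(x, ρ, R) traversals of D(x; ρ, R)) ≤ K (ρ/R)^λ` for
  `0 < δ ≤ δ₀`, `δ ≤ ρ < R ≤ 1`, from the leftmost bound for the exchanged data (threshold
  `k(x, 2ρ, R − ρ)`, constant `max K 1 · 4^λ`);
* `exists_isTightMeasureSet_spinInterfaceLaw_rightmost`, `isTightAlongMesh_spinInterfaceCurve_rightmost`
  — tightness of the laws of the rightmost interface near `δ = 0` (CDHKS §2, Thm. 3, for the
  rightmost interface of §1), by Aizenman–Burchard's criterion exactly as for the leftmost one.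

Everything is proved, modulo the named fact `fkIsing_rsw` taken as a hypothesis (as in the
leftmost file). The all-interfaces form `InterfaceSLETightness.spinInterface_traversalBound` is
not implied (see the module docstring of `InterfaceSLETightnessProofs.lean`).

## References

* D. Chelkak, H. Duminil-Copin, C. Hongler, A. Kemppainen, S. Smirnov, C. R. Math. Acad. Sci.
  Paris 352 (2014) 157–161, §1, §2 Thm. 3 and Rem. 4. [CDHKSCRAS2014]
* M. Aizenman, A. Burchard, Duke Math. J. 99 (1999), §1.b (1.3), Thm. 1.1–1.2, §2.a.
  [AizenmanBurchardDuke1999]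
* S. Friedli, Y. Velenik, *Statistical Mechanics of Lattice Systems* (2017), §3.7.1 (spin-flip
  symmetry at `h = 0`), eq. (3.26). [FriedliVelenik2017]
-/

noncomputable section

open MeasureTheory Filter Topology Set Metric
open scoped ENNReal NNReal

namespace Literature.Probability.LatticeModels

/-! ### Exchanging the marked points of a Dobrushin domain -/

section DomainSwap

open RandomPlanarGeometry

variable (D : RandomPlanarGeometry.DobrushinDomain)

/-- **The Dobrushin domain with the two marked points exchanged**, `(D; b, a)`: the same Jordan
domain with its boundary loop re-based at `b` (parameter shifted by `mark 1`; a shifted simple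
loop is simple, `Function.Periodic.injOn_shift` of `ArcHullDomains.lean`) and marked parameters
`0` (the point `b`) and `mark 0 + 1 - mark 1` (the point `a`). Its first arc is the arc `(ba)` of
`D` and its second arc is `(ab)` (`arc_dobrushinDomainSwap_zero/one`). (Werner 2007, §2: a
Dobrushin domain is a Jordan domain with two marked boundary points; CDHKS 2014, §1.)
[cite: CDHKSCRAS2014, §1] -/
def dobrushinDomainSwap : RandomPlanarGeometry.DobrushinDomain where
  carrier := D.carrier
  boundary t := D.boundary (t + D.mark 1)
  isOpen := D.isOpen
  isBounded := D.isBounded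
  isConnected := D.isConnected
  continuous_boundary := D.continuous_boundary.comp (continuous_add_const _)
  periodic_boundary t := by
    simp only
    rw [add_right_comm]
    exact D.periodic_boundary _
  injOn_boundary := D.periodic_boundary.injOn_shift D.injOn_boundary _
  range_boundary := by rw [RandomPlanarGeometry.range_comp_add_right, D.range_boundary]
  mark := ![0, D.mark 0 + 1 - D.mark 1]
  strictMono_mark := by
    have h1 : D.mark 1 < 1 := (D.mark_mem 1).2
    have h0 : 0 ≤ D.mark 0 := (D.mark_mem 0).1
    refine Fin.strictMono_iff_lt_succ.2 fun k ↦ ?_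
    fin_cases k
    show (0 : ℝ) < D.mark 0 + 1 - D.mark 1
    linarith
  mark_mem k := by
    have h1 : D.mark 1 < 1 := (D.mark_mem 1).2
    have h0 : 0 ≤ D.mark 0 := (D.mark_mem 0).1
    have h01 : D.mark 0 < D.mark 1 := D.strictMono_mark (show (0 : Fin 2) < 1 by decide)
    fin_cases k
    · show (0 : ℝ) ∈ Ico 0 1
      simp
    · show D.mark 0 + 1 - D.mark 1 ∈ Ico 0 1
      constructor <;> linarith

/-- The carrier is unchanged. [folklore] -/
@[simp] theorem carrier_dobrushinDomainSwap : (dobrushinDomainSwap D).carrier = D.carrier := rfl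

/-- The re-based boundary loop. [folklore] -/
@[simp] theorem boundary_dobrushinDomainSwap (t : ℝ) :
    (dobrushinDomainSwap D).boundary t = D.boundary (t + D.mark 1) := rfl

/-- The first marked parameter is `0`. [folklore] -/
@[simp] theorem mark_dobrushinDomainSwap_zero : (dobrushinDomainSwap D).mark 0 = 0 := rfl

/-- The second marked parameter is `mark 0 + 1 - mark 1`. [folklore] -/
@[simp] theorem mark_dobrushinDomainSwap_one :
    (dobrushinDomainSwap D).mark 1 = D.mark 0 + 1 - D.mark 1 := rfl

/-- The first marked point of `(D; b, a)` is `b`. [folklore] -/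
@[simp] theorem pt_dobrushinDomainSwap_zero : (dobrushinDomainSwap D).pt 0 = D.pt 1 := by
  simp [MarkedDomain.pt]

/-- The second marked point of `(D; b, a)` is `a`. [folklore] -/
@[simp] theorem pt_dobrushinDomainSwap_one : (dobrushinDomainSwap D).pt 1 = D.pt 0 := by
  simp only [MarkedDomain.pt, boundary_dobrushinDomainSwap, mark_dobrushinDomainSwap_one,
    sub_add_cancel]
  exact D.periodic_boundary _

/-- `nextMark 0 = mark 1` for a Dobrushin domain. [folklore] -/
theorem nextMark_zero (D' : RandomPlanarGeometry.DobrushinDomain) : D'.nextMark 0 = D'.mark 1 := by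
  simp [MarkedDomain.nextMark]

/-- `nextMark 1 = mark 0 + 1` for a Dobrushin domain. [folklore] -/
theorem nextMark_one (D' : RandomPlanarGeometry.DobrushinDomain) : D'.nextMark 1 = D'.mark 0 + 1 := by
  simp [MarkedDomain.nextMark]

/-- The first arc of `(D; b, a)` is the arc `(ba)` of `(D; a, b)`. [cite: CDHKSCRAS2014, §1] -/
@[simp] theorem arc_dobrushinDomainSwap_zero : (dobrushinDomainSwap D).arc 0 = D.arc 1 := by
  rw [MarkedDomain.arc, MarkedDomain.arc, nextMark_zero, nextMark_one, mark_dobrushinDomainSwap_zero,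
    mark_dobrushinDomainSwap_one]
  rw [show (dobrushinDomainSwap D).boundary = D.boundary ∘ fun t ↦ t + D.mark 1 from rfl,
    Set.image_comp, Set.image_add_const_Icc, zero_add, sub_add_cancel]

/-- The second arc of `(D; b, a)` is the arc `(ab)` of `(D; a, b)`. [cite: CDHKSCRAS2014, §1] -/
@[simp] theorem arc_dobrushinDomainSwap_one : (dobrushinDomainSwap D).arc 1 = D.arc 0 := by
  rw [MarkedDomain.arc, MarkedDomain.arc, nextMark_zero, nextMark_one, mark_dobrushinDomainSwap_zero,
    mark_dobrushinDomainSwap_one]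
  rw [show (dobrushinDomainSwap D).boundary = D.boundary ∘ fun t ↦ t + D.mark 1 from rfl,
    Set.image_comp, Set.image_add_const_Icc, zero_add, sub_add_cancel]
  have hper : D.boundary ∘ (fun t ↦ t + 1) = D.boundary := funext fun t ↦ D.periodic_boundary t
  rw [show Icc (D.mark 0 + 1) (1 + D.mark 1) = (fun t ↦ t + 1) '' Icc (D.mark 0) (D.mark 1) by
    rw [Set.image_add_const_Icc, add_comm 1], ← Set.image_comp, hper]

variable {D} {E : ℝ → DiscreteDobrushin}

/-- **Exchanging the arcs of a discretisation of `(D; a, b)` gives a discretisation of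
`(D; b, a)`.** (CDHKS 2014, §1.) [cite: CDHKSCRAS2014, §1] -/
theorem IsDiscretisation.swap (h : IsDiscretisation D E) :
    IsDiscretisation (dobrushinDomainSwap D) fun δ ↦ (E δ).swap where
  Ω_eq δ := h.Ω_eq δ
  δ_eq δ := h.δ_eq δ
  tendsto_arcA := by
    simpa only [arc_dobrushinDomainSwap_zero, DiscreteDobrushin.swap_arcA] using h.tendsto_arcB
  tendsto_arcB := by
    simpa only [arc_dobrushinDomainSwap_one, DiscreteDobrushin.swap_arcB] using h.tendsto_arcA
  tendsto_zdABEdges := by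
    simpa only [DiscreteDobrushin.zdABEdges_swap, pt_dobrushinDomainSwap_zero,
      pt_dobrushinDomainSwap_one, Set.pair_comm] using h.tendsto_zdABEdges
  eventually_isZdAdmissible := h.eventually_isZdAdmissible.mono fun _ hδ ↦ hδ.swap

end DomainSwap

/-! ### Traversals are stable under reparametrisation distance `0` -/

section Reparam

/-- **Separate traversals pass to curves at reparametrisation distance `0`, up to shrinking the
shell**: if `γ₁` has `k` separate traversals of `D(x; r, R)` and `reparamDist γ₁ γ₂ = 0`, then
for every `ε > 0` the curve `γ₂` has `k` separate traversals of `D(x; r + ε, R - ε)` (choose an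
increasing reparametrisation `φ` with `‖γ₁ - γ₂ ∘ φ‖ < ε` and transport the traversal times by
`φ`). (Aizenman–Burchard 1999, §2.a: curves modulo reparametrisation; §1.b (1.3).)
[cite: AizenmanBurchardDuke1999, §1.b (1.3) and §2.a] -/
theorem hasTraversals_of_reparamDist_eq_zero {γ₁ γ₂ : RandomPlanarGeometry.Curve ℂ}
    (h : γ₁.reparamDist γ₂ = 0) {k : ℕ} {x : ℂ} {r R : ℝ} (ht : γ₁.HasTraversals k x r R)
    {ε : ℝ} (hε : 0 < ε) : γ₂.HasTraversals k x (r + ε) (R - ε) := by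
  have hlt : (⨅ φ : unitInterval ≃o unitInterval,
      dist γ₁.toContinuousMap (γ₂.reparam φ).toContinuousMap) < ε := by
    change γ₁.reparamDist γ₂ < ε
    rw [h]; exact hε
  obtain ⟨φ, hφ⟩ := exists_lt_of_ciInf_lt hlt
  have hpt : ∀ t, dist (γ₁ t) (γ₂ (φ t)) < ε := fun t ↦
    lt_of_le_of_lt (ContinuousMap.dist_apply_le_dist (f := γ₁.toContinuousMap)
      (g := (γ₂.reparam φ).toContinuousMap) t) hφ
  obtain ⟨s, t, hst, hsep⟩ := ht
  refine ⟨fun i ↦ φ (s i), fun i ↦ φ (t i), fun i ↦ ⟨φ.monotone (hst i).1, ?_⟩,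
    fun i j hij ↦ φ.lt_iff_lt.2 (hsep hij)⟩
  have near : ∀ u : unitInterval, dist (γ₁ u) x ≤ r → dist (γ₂ (φ u)) x ≤ r + ε := fun u hu ↦ by
    have := dist_triangle (γ₂ (φ u)) (γ₁ u) x
    have h2 : dist (γ₂ (φ u)) (γ₁ u) < ε := by rw [dist_comm]; exact hpt u
    linarith
  have far : ∀ u : unitInterval, R ≤ dist (γ₁ u) x → R - ε ≤ dist (γ₂ (φ u)) x := fun u hu ↦ by
    have := dist_triangle (γ₁ u) (γ₂ (φ u)) x
    linarith [hpt u]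
  rcases (hst i).2 with ⟨h1, h2⟩ | ⟨h1, h2⟩
  · exact Or.inl ⟨near _ h1, far _ h2⟩
  · exact Or.inr ⟨far _ h1, near _ h2⟩

/-- **Traversals of the polygon of a reversed list of dual edges**: if the polygon of `γ.reverse`
traverses `D(x; r, R)` `k` times then the polygon of `γ` traverses `D(x; r + ε, R - ε)` `k`
times, for every `ε > 0` (the polygon of the reversed list is the time reversal of the polygon
modulo reparametrisation, `reparamDist_polyline_reverse`, and time reversal preserves separate
traversals). [cite: AizenmanBurchardDuke1999, §2.a] -/
theorem hasTraversals_spinPolygon_of_reverse {δ : ℝ} {γ : List (Sym2 (Site 2))} {k : ℕ} {x : ℂ}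
    {r R : ℝ} (h : (spinPolygon δ γ.reverse).HasTraversals k x r R) {ε : ℝ} (hε : 0 < ε) :
    (spinPolygon δ γ).HasTraversals k x (r + ε) (R - ε) := by
  rw [spinPolygon_eq, List.map_reverse] at h
  have h0 := Literature.Probability.Percolation.reparamDist_polyline_reverse (γ.map (dualMedialPoint δ))
  have h' := hasTraversals_of_reparamDist_eq_zero h0 h hε
  exact RandomPlanarGeometry.Curve.hasTraversals_reverse_iff.1 h'

end Reparam

/-! ### The spin flip exchanges the two Dobrushin measures -/

section Flip

variable {E : DiscreteDobrushin}

/-- On the outer boundary of the free volume, the flipped boundary condition of `(Ω_δ; A, B)`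
is the boundary condition of `(Ω_δ; B, A)` (admissible data: the outer boundary lies in
`zdBoundary = zdArcA ⊔ zdArcB`). [cite: CDHKSCRAS2014, §1] -/
theorem neg_dobrushinBC_eq_of_mem_outerBoundary (hE : E.IsZdAdmissible) {y : Site 2}
    (hy : y ∈ outerBoundary (discreteDomainGraph E.Ω E.δ) (zdInteriorFinset E)) :
    (-dobrushinBC E) y = dobrushinBC E.swap y := by
  classical
  rw [mem_outerBoundary_iff] at hy
  obtain ⟨hyΛ, z, -, hyz⟩ := hy
  have hymesh : y ∈ meshDomain E.Ω E.δ := (discreteDomainGraph_adj_iff.1 hyz).2.1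
  have hyb : y ∈ E.zdBoundary := by
    by_contra hyb
    exact hyΛ (by
      rw [← Finset.mem_coe, coe_zdInteriorFinset hE.isBounded hE.delta_pos]
      exact ⟨hymesh, hyb⟩)
  rcases hE.zdBoundary_subset hyb with hA | hB
  · have hB : y ∉ E.zdArcB := Set.disjoint_left.1 hE.disjoint hA
    simp [dobrushinBC, hA, hB]
  · have hA : y ∉ E.zdArcA := Set.disjoint_right.1 hE.disjoint hB
    simp [dobrushinBC, hA, hB]

/-- **The global spin flip maps the `±` Dobrushin Ising measure of `(Ω_δ; A, B)` to that of
`(Ω_δ; B, A)`**, on events determined by the free spins: for admissible data, every `β` and every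
measurable event `S` determined by the spins of the free volume,
`μ_{(Ω_δ;A,B)}(-σ ∈ S) = μ_{(Ω_δ;B,A)}(S)`. Proof: at `h = 0` the flip maps `μ^η_Λ` to `μ^{-η}_Λ`
(`isingMeasure_fixed_map_neg`, Friedli–Velenik §3.7.1), and `-η` agrees with the boundary
condition of the exchanged arcs on the outer boundary of `Λ` (locality, eq. (3.26)).
[cite: FriedliVelenik2017, §3.7.1; CDHKSCRAS2014, §1] -/
theorem isingZdDobrushinMeasure_preimage_neg (hE : E.IsZdAdmissible) (β : ℝ)
    {S : Set (SpinConfig (Site 2))} (hSm : MeasurableSet S)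
    (hSdet : ∀ σ₁ σ₂ : SpinConfig (Site 2), (∀ x ∈ zdInteriorFinset E, σ₁ x = σ₂ x) → (σ₁ ∈ S ↔ σ₂ ∈ S)) :
    isingZdDobrushinMeasure E β ((fun σ : SpinConfig (Site 2) ↦ -σ) ⁻¹' S) =
      isingZdDobrushinMeasure E.swap β S := by
  classical
  rw [isingZdDobrushinMeasure, isingZdDobrushinMeasure, ← Measure.map_apply measurable_neg hSm,
    isingMeasure_fixed_map_neg]
  exact isingMeasure_fixed_congr_of_eqOn_outerBoundary _ _ β 0
    (fun y hy ↦ neg_dobrushinBC_eq_of_mem_outerBoundary hE hy) hSm hSdet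

end Flip

/-! ### (H1) for the rightmost interface -/

/-- **The Aizenman–Burchard traversal bound (H1) for the rightmost critical Ising interface,
from `fkIsing_rsw`.** For every Jordan domain with two marked boundary points and every family of
square-lattice discretisations, there are `k`, `K ≥ 0`, `λ > 2` and `δ₀ > 0` such that for
`0 < δ ≤ δ₀` (admissible), `δ ≤ ρ < R ≤ 1` and every `x`, the probability that the polygon of
the rightmost Dobrushin interface traverses `D(x; ρ, R)` `k(x, ρ, R)` times is at most
`K (ρ/R)^λ` — the companion of `leftmostInterface_traversalBound_of_fkIsing_rsw` for the other
interface named in CDHKS 2014, §1 ("the rightmost (or the leftmost) interface"). Proof: the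
rightmost interface of `σ` is the reversed leftmost interface of `-σ` for the exchanged arcs; the
event is transported by the spin flip (`isingZdDobrushinMeasure_preimage_neg`, locality
`leftmostInterface_congr`) to the leftmost event for the discretisation `(E δ).swap` of
`(D; b, a)` in the shell `D(x; 2ρ, R − ρ)` (`hasTraversals_spinPolygon_of_reverse`), where the
leftmost bound applies; `K ↦ max K 1 · 4^λ`.
[cite: CDHKSCRAS2014, §1 and §2 Rem. 4; KemppainenSmirnov2017, Rem. 2.10] -/
theorem rightmostInterface_traversalBound_of_fkIsing_rsw (h₁ : fkIsing_rsw) :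
    ∀ (D : RandomPlanarGeometry.DobrushinDomain) (E : ℝ → DiscreteDobrushin), IsDiscretisation D E →
    ∃ (k : ℂ → ℝ → ℝ → ℕ) (K lam δ₀ : ℝ), 0 ≤ K ∧ 2 < lam ∧ 0 < δ₀ ∧
      ∀ δ ∈ Set.Ioc (0 : ℝ) δ₀, (E δ).IsZdAdmissible →
        ∀ (x : ℂ) (ρ R : ℝ), δ ≤ ρ → ρ < R → R ≤ 1 →
          isingZdDobrushinMeasure (E δ) criticalBetaTwo
            {σ | (spinPolygon δ (rightmostInterface (E δ) σ)).HasTraversals (k x ρ R) x ρ R} ≤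
            ENNReal.ofReal (K * (ρ / R) ^ lam) := by
  classical
  intro D E hE
  obtain ⟨k, K, lam, δ₀, hK, hlam, hδ₀, hbd⟩ :=
    leftmostInterface_traversalBound_of_fkIsing_rsw h₁ (dobrushinDomainSwap D) (fun δ ↦ (E δ).swap) hE.swap
  have hlam0 : 0 ≤ lam := by linarith
  refine ⟨fun x ρ R ↦ k x (2 * ρ) (R - ρ), max K 1 * 4 ^ lam, lam, δ₀, by positivity, hlam, hδ₀, ?_⟩
  rintro δ ⟨hδ0, hδ1⟩ hadm x ρ R hδρ hρR hR1
  have hρ : 0 < ρ := hδ0.trans_le hδρ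
  have hRpos : 0 < R := hρ.trans hρR
  have h4 : (4 : ℝ) ^ lam * (ρ / R) ^ lam = (4 * ρ / R) ^ lam := by
    rw [mul_div_assoc, Real.mul_rpow (by norm_num) (by positivity)]
  by_cases hsmall : R ≤ 4 * ρ
  · -- trivial regime
    calc _ ≤ (1 : ℝ≥0∞) := prob_le_one
      _ ≤ ENNReal.ofReal (max K 1 * 4 ^ lam * (ρ / R) ^ lam) := by
        rw [← ENNReal.ofReal_one]
        apply ENNReal.ofReal_le_ofReal
        rw [mul_assoc, h4]
        have h1 : 1 ≤ 4 * ρ / R := by rw [le_div_iff₀ hRpos]; linarith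
        nlinarith [le_max_right K 1, Real.one_le_rpow h1 hlam0]
  push Not at hsmall
  -- the main regime: transport to the leftmost interface of the exchanged data
  set E' : DiscreteDobrushin := (E δ).swap with hE'
  have hadm' : E'.IsZdAdmissible := hadm.swap
  set S₁ : Set (SpinConfig (Site 2)) :=
    {τ | (spinPolygon δ (leftmostInterface E' τ)).HasTraversals (k x (2 * ρ) (R - ρ)) x (2 * ρ) (R - ρ)}
    with hS₁
  have hS₁det : ∀ σ₁ σ₂ : SpinConfig (Site 2), (∀ y ∈ zdInteriorFinset (E δ), σ₁ y = σ₂ y) →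
      (σ₁ ∈ S₁ ↔ σ₂ ∈ S₁) := by
    intro σ₁ σ₂ hσ
    simp only [hS₁, mem_setOf_eq]
    rw [leftmostInterface_congr hadm' (by simpa [hE'] using hσ)]
  have hS₁m : MeasurableSet S₁ := measurableSet_of_determined _ hS₁det
  have hsub : {σ | (spinPolygon δ (rightmostInterface (E δ) σ)).HasTraversals (k x (2 * ρ) (R - ρ)) x ρ R} ⊆
      (fun σ : SpinConfig (Site 2) ↦ -σ) ⁻¹' S₁ := by
    intro σ hσ
    simp only [mem_setOf_eq, rightmostInterface_eq] at hσ
    simp only [hS₁, mem_preimage, mem_setOf_eq]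
    have := hasTraversals_spinPolygon_of_reverse hσ hρ
    rwa [← two_mul] at this
  have hmeas : isingZdDobrushinMeasure (E δ) criticalBetaTwo
      {σ | (spinPolygon δ (rightmostInterface (E δ) σ)).HasTraversals (k x (2 * ρ) (R - ρ)) x ρ R} ≤
      isingZdDobrushinMeasure E' criticalBetaTwo S₁ := by
    refine (measure_mono hsub).trans ?_
    rw [isingZdDobrushinMeasure_preimage_neg hadm criticalBetaTwo hS₁m hS₁det]
  -- the leftmost bound in the shell `D(x; 2ρ, R - ρ)`
  have hb := hbd δ ⟨hδ0, hδ1⟩ hadm' x (2 * ρ) (R - ρ) (by linarith) (by linarith) (by linarith)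
  refine hmeas.trans (hb.trans (ENNReal.ofReal_le_ofReal ?_))
  -- `K (2ρ/(R-ρ))^λ ≤ max K 1 · 4^λ (ρ/R)^λ`
  have hRρ : 0 < R - ρ := by linarith
  have hratio : 2 * ρ / (R - ρ) ≤ 4 * ρ / R := by
    rw [div_le_div_iff₀ hRρ hRpos]; nlinarith
  have hpow : (2 * ρ / (R - ρ)) ^ lam ≤ (4 * ρ / R) ^ lam :=
    Real.rpow_le_rpow (by positivity) hratio hlam0
  rw [mul_assoc, h4]
  have h0 : 0 ≤ (2 * ρ / (R - ρ)) ^ lam := by positivity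
  nlinarith [le_max_left K 1, le_max_right K 1]

/-! ### Tightness of the laws of the rightmost interface -/

/-- **Tightness of the laws of the rightmost critical Ising interface near `δ = 0`, from
`fkIsing_rsw`** (CDHKS 2014, §2 Thm. 3, for the rightmost interface of §1; here via
Aizenman–Burchard, Thm. 1.2): for a discretisation `E` of `(D; a, b)` there is `δ₂ > 0` such
that the laws `spinInterfaceLaw D E (fun δ ↦ rightmostInterface (E δ)) δ`, `δ ∈ (0, δ₂]`, form a
tight set of measures on `CurveClass ℂ`. The proof is that of
`exists_isTightMeasureSet_spinInterfaceLaw_leftmost` with (H1) supplied by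
`rightmostInterface_traversalBound_of_fkIsing_rsw`; the rightmost interface is a Dobrushin
interface for admissible data (`isDobrushinInterface_rightmostInterface`).
[cite: CDHKSCRAS2014, §2 Thm. 3; AizenmanBurchardDuke1999, Thm. 1.2] -/
theorem exists_isTightMeasureSet_spinInterfaceLaw_rightmost (h₁ : fkIsing_rsw)
    {D : RandomPlanarGeometry.DobrushinDomain} {E : ℝ → DiscreteDobrushin} (hE : IsDiscretisation D E) :
    ∃ δ₂ > 0, IsTightMeasureSet
      (spinInterfaceLaw D E (fun δ ↦ rightmostInterface (E δ)) '' Set.Ioc 0 δ₂) := by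
  obtain ⟨r, hr⟩ := D.isBounded.subset_closedBall (0 : ℂ)
  obtain ⟨k, K, lam, δ₀, hK, hlam, hδ₀, hbd⟩ := rightmostInterface_traversalBound_of_fkIsing_rsw h₁ D E hE
  obtain ⟨δ₁, hδ₁, hadm⟩ := exists_forall_isZdAdmissible hE.eventually_isZdAdmissible
  refine ⟨min (min δ₀ 1) (δ₁ / 2), lt_min (lt_min hδ₀ one_pos) (by positivity), ?_⟩
  set δ₂ : ℝ := min (min δ₀ 1) (δ₁ / 2) with hδ₂
  have hT : Set.Ioc 0 δ₂ ⊆ Set.Ioc (0 : ℝ) 1 :=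
    Set.Ioc_subset_Ioc_right ((min_le_left _ _).trans (min_le_right _ _))
  have hT₀ : ∀ δ ∈ Set.Ioc 0 δ₂, δ ∈ Set.Ioc (0 : ℝ) δ₀ := fun δ hδ ↦
    ⟨hδ.1, hδ.2.trans ((min_le_left _ _).trans (min_le_left _ _))⟩
  have hT₁ : ∀ δ ∈ Set.Ioc 0 δ₂, (E δ).IsZdAdmissible := fun δ hδ ↦
    hadm δ hδ.1 (hδ.2.trans_lt ((min_le_right _ _).trans_lt (by linarith)))
  have hr₀ : (0 : ℝ) ≤ max r 0 + 1 := by positivity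
  have hr' : closedBall (0 : ℂ) r ⊆ closedBall 0 (max r 0 + 1) :=
    closedBall_subset_closedBall (by linarith [le_max_left r 0])
  have key := RandomPlanarGeometry.isTightMeasureSet_of_traversalBounds (E := ℂ)
    (isCompact_closedBall (0 : ℂ) (max r 0 + 1)) (C := 9 * (max r 0 + 1 + 2) ^ 2) (d := 2)
    zero_le_two (fun ρ hρ hρ1 ↦ RandomPlanarGeometry.exists_finset_card_le_cover_closedBall hr₀ ρ hρ hρ1)
    (Ω := fun _ ↦ SpinConfig (Site 2)) (fun δ ↦ isingZdDobrushinMeasure (E δ) criticalBetaTwo)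
    (fun δ σ ↦ spinOrientedPolygon D δ (rightmostInterface (E δ) σ))
    (fun x ρ R ↦ max spinTraversalCutoff (k x ρ R)) hK hlam hT ?_ ?_
  · simpa only [spinInterfaceLaw, spinInterfaceCurve_comp_eq] using key
  · -- (H0) from (C0), for every `σ`
    intro δ hδ
    have hδE : (E δ).δ = δ := hE.δ_eq δ
    have hΩE : (E δ).Ω ⊆ closedBall (0 : ℂ) r := by rw [hE.Ω_eq δ]; exact hr
    have hδ0 : 0 < (E δ).δ := by rw [hδE]; exact hδ.1
    refine ae_of_all _ fun σ ↦ ?_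
    have hγ : IsDobrushinInterface (E δ) σ (rightmostInterface (E δ) σ) :=
      isDobrushinInterface_rightmostInterface (hT₁ δ hδ) σ
    refine ⟨?_, fun x ρ R _ hρδ hρR htr ↦ ?_⟩
    · have h := spinPolygon_range_subset hγ hΩE
      rw [hδE] at h
      rw [range_spinOrientedPolygon]
      exact h.trans hr'
    · have h := not_hasTraversals_spinPolygon hδ0 hγ (x := x) (ρ := ρ) (R := R)
        (by rw [hδE]; exact hρδ) hρR
      rw [hδE] at h
      rw [hasTraversals_spinOrientedPolygon_iff] at htr
      exact h (htr.of_le (le_max_left _ _))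
  · -- (H1) from the traversal bound for the rightmost interface
    intro δ hδ x ρ R hδρ hρR hR1
    refine le_trans (measure_mono fun σ hσ ↦ ?_) (hbd δ (hT₀ δ hδ) (hT₁ δ hδ) x ρ R hδρ hρR hR1)
    simp only [mem_setOf_eq, hasTraversals_spinOrientedPolygon_iff] at hσ ⊢
    exact hσ.of_le (le_max_right _ _)

/-- The same tightness in the eventual, event-level vocabulary `IsTightAlongMesh` of
`SLEConvergenceCriterion.lean` (the interfaces are a.e.-measurable under the finitely supported
Ising measures). [cite: CDHKSCRAS2014, §2 Thm. 3] -/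
theorem isTightAlongMesh_spinInterfaceCurve_rightmost (h₁ : fkIsing_rsw)
    {D : RandomPlanarGeometry.DobrushinDomain} {E : ℝ → DiscreteDobrushin} (hE : IsDiscretisation D E) :
    RandomPlanarGeometry.IsTightAlongMesh (Ωδ := fun _ ↦ SpinConfig (Site 2))
      (fun δ σ ↦ spinInterfaceCurve D δ (rightmostInterface (E δ) σ))
      (fun δ ↦ isingZdDobrushinMeasure (E δ) criticalBetaTwo) := by
  obtain ⟨δ₂, hδ₂, h⟩ := exists_isTightMeasureSet_spinInterfaceLaw_rightmost h₁ hE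
  exact RandomPlanarGeometry.isTightAlongMesh_of_isTightMeasureSet_image
    (Filter.Eventually.of_forall fun δ ↦ aemeasurable_isingZdDobrushinMeasure _ _ _) hδ₂ h

end Literature.Probability.LatticeModels

end
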